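import Summits.AtomisticToContinuum.BoseEinsteinCondensation.Theorems.BECConjugateDominationHardCoreExtensionBoundedPositiveMinimiserHolds
import Summits.AtomisticToContinuum.BoseEinsteinCondensation.Theorems.BECConjugateDominationHardCoreExtensionAlphaPhys
import Summits.AtomisticToContinuum.BoseEinsteinCondensation.Theorems.BECConjugateDominationHardCoreExtensionAlphaSoft
import Summits.AtomisticToContinuum.BoseEinsteinCondensation.Theorems.BECConjugateDominationHardCoreExtensionPairCutoff
import Summits.AtomisticToContinuum.BoseEinsteinCondensation.Theorems.BECConjugateDominationHardCoreExtensionKineticTightness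
import Summits.AtomisticToContinuum.BoseEinsteinCondensation.Theorems.BECConjugateDominationHardCoreExtensionUniformGapTransfer
import Summits.AtomisticToContinuum.BoseEinsteinCondensation.Theorems.BECConjugateDominationHardCoreExtensionPairShellMass
import Summits.AtomisticToContinuum.BoseEinsteinCondensation.Theorems.BECConjugateDominationHardCoreExtensionPairShellMassUniform
import Summits.AtomisticToContinuum.BoseEinsteinCondensation.Theorems.BECConjugateDominationHardCoreExtensionPairCutoffUniform
import Summits.AtomisticToContinuum.BoseEinsteinCondensation.Theorems.BECConjugateDominationHardCoreExtensionAlphaInt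
import Summits.AtomisticToContinuum.BoseEinsteinCondensation.Theorems.BECConjugateDominationHardCoreExtensionFKSupBound
import Summits.AtomisticToContinuum.BoseEinsteinCondensation.Theorems.BECConjugateDominationHardCoreExtensionInteractionExcess
import Summits.AtomisticToContinuum.BoseEinsteinCondensation.Theorems.BECConjugateDominationHardCoreExtensionTruncationEnergyConvergenceAll
import Summits.AtomisticToContinuum.BoseEinsteinCondensation.Theorems.BECConjugateDominationHardCoreExtensionResidueSimplicity
import Literature.MathematicalPhysics.QuantumManyBody.BoseGasThermodynamicLimitRuelle
import Literature.MathematicalPhysics.QuantumManyBody.BoseGasDirichletWall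
import Literature.Barriers.AtomisticToContinuum.KineticGapLengthScalesThermodynamicWindow
import HarnessLib

/-!
# The fixed-volume transfer: uniform minimiser BEC over bounded potentials ⇒ near-minimiser BEC for every potential
# (line `third-law-current-floor`, crux `BECConjugateDomination.HardCoreExtension`, stmt-AtomisticToContinuum-11786 — lead c5)

This file carries the TRANSFER of the registered skeleton `Cruxes/HardCoreExtension/Lines/third_law_current_floor.lean`
(v12.3) into the tree as a sorry-free theorem, stated against ONE thermodynamic hypothesis of BEC type and ONE
fixed-volume hypothesis, both per potential `v` of range `≤ R`:

* **U(R)** — *uniform minimiser BEC over the bounded admissible class of range `≤ R`*: there is `ρ₀ > 0` such that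
  for `0 < ρ < ρ₀` there is `c > 0` with: for all large `N`, for EVERY bounded admissible `w` of range `≤ R` and every
  positive real exact minimiser `Ψ` of the periodic `N`-body energy of `w` on the torus of side `(N/ρ)^{1/3}`,
  `n₀(Ψ) ≥ cN`. (This is exactly the conclusion of the landed uniform chain glue `stub_uniformChainGlue` fed by the
  line's S1+S2 floor and S3; any other mechanism proving it inherits the transfer.)
* **(β')(v)** — a Ky Fan gap of the truncations `vₙ = min(v, n)`, uniform in the level, dilute, eventually in `N`
  (needed only for non-integrable `v`; supplied by class in `…ResidueSimplicity.lean`: unconditional for bounded `v`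
  and for `v` locally bounded on `(0,∞)`, modulo Lemma G for hard cores, modulo G + X in general).

**Theorem `periodicBEC_of_uniformMinimiserBEC`.** U(R) and (β')(v) imply, for every admissible `v` of range `≤ R`,
the near-minimiser form of periodic BEC — `∃ ρ₀ > 0, ∀ ρ ∈ (0,ρ₀), ∃ c > 0, ∀ᶠ N, ∃ δ > 0`, every periodic trial state
with `periodicEnergy ≤ E₀^per + δ` has constant-mode occupation `≥ cN` — i.e. verbatim the hypothesis of the route's
`BoundaryTransferWeak v`. Proof: U(R) gives minimiser BEC `n₀ ≥ cN` for every truncation `vₙ` (bounded, same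
range), whose positive minimisers exist (`boundedPositiveMinimiser_holds`); for NON-INTEGRABLE `v` the (α') energy
convergence `E₀(vₙ) ↑ E₀(v)` at fixed `(N, L)` (`truncationEnergyConvergence_all`: every admissible `v`, beyond a
`v`-dependent side length) and (β')(v) feed the landed transfer `stub_truncationTransferOfUniformGap`, giving
`n₀ ≥ (c/2)N` for all `δ`-near-minimisers of `v`; for INTEGRABLE `v` the Ky Fan gap of `v` itself (Faris–Simon, tree)
and the Feynman–Kac minimisers of the truncations as near-minimisers of `v` (`AlphaInt.truncationTransfer_integrable_of`
∘ I1 ∘ I2, landed) do the same without (α')/(β').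

References: E. H. Lieb, R. Seiringer, J. P. Solovej, J. Yngvason, *The Mathematics of the Bose Gas and its Condensation*
(2005), §1.2 and Ch. 2; M. Reed, B. Simon, *Methods of Modern Mathematical Physics IV* (1978), Thm XIII.44, XIII.47, XIII.64;
B. Simon, J. Operator Theory 1 (1979) 37 (maximal and minimal Schrödinger forms), Thm. 4.1.
-/

noncomputable section

namespace Summit.AtomisticToContinuum.BoseEinsteinCondensation.Cruxes.HardCoreExtension.ThirdLawCurrentFloorAlt

open MeasureTheory Filter
open scoped ENNReal NNReal BigOperators Topology
open Literature.MathematicalPhysics.QuantumManyBody.BoseGas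
open Summit.AtomisticToContinuum.BoseEinsteinCondensation.Cruxes.HardCoreExtension.ThirdLawCurrentFloor

/-! ## (α') truncation energy convergence for every admissible potential -/

/-- **(α') for every admissible `v`, beyond a `v`-dependent side length `L₀`**: the bounded class trivially (the
truncation IS `v` on `[0,∞)` eventually; `L₀ = 0`), the physical hard-core class by the landed composition node
`stub_truncationEnergyConvergencePhys_of` fed with the landed E2, P3, P4 (`L₀ = 4a`), the soft-core class by
`stub_truncationEnergyConvergenceSoft_of` fed with E2U, P3, P4U (`L₀ = 4(a+a₀)`), every other `v` by the landed P1
`stub_truncationEnergyConvergenceAll` (`L₀ = 0`). [cite: ReedSimonIV1978, Thm. XIII.64] -/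
theorem truncationEnergyConvergence_all :
    ∀ v : ℝ → ℝ≥0∞, IsRepulsiveFiniteRange v →
      ∃ L₀ : ℝ, ∀ (N : ℕ) (L : ℝ), 0 < L → L₀ < L →
      periodicGroundStateEnergy v N L ≠ ⊤ → ∀ ε : ℝ, 0 < ε → ∃ n₀ : ℕ, ∀ n : ℕ, n₀ ≤ n →
        periodicGroundStateEnergy v N L ≤
          periodicGroundStateEnergy (fun r => min (v r) (n : ℝ≥0∞)) N L + ENNReal.ofReal ε := by
  intro v hv
  by_cases hb : ∃ C : ℝ≥0, ∀ r : ℝ, 0 ≤ r → v r ≤ C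
  · obtain ⟨C, hC⟩ := hb
    refine ⟨0, fun N L hL _ hE ε hε => ⟨⌈(C : ℝ)⌉₊, fun n hn => ?_⟩⟩
    have hn' : (C : ℝ) ≤ n := (Nat.le_ceil _).trans (by exact_mod_cast hn)
    have heq : ∀ r, 0 ≤ r → v r = min (v r) (n : ℝ≥0∞) := fun r hr =>
      (min_eq_left ((hC r hr).trans (by exact_mod_cast hn'))).symm
    rw [← periodicGroundStateEnergy_congr_of_eqOn_nonneg heq N L]
    exact le_self_add
  by_cases hphys : ∃ a : ℝ, 0 < a ∧ ∃ M : ℝ≥0∞, M ≠ ⊤ ∧ (∀ r, 0 ≤ r → r < a → v r = ⊤) ∧ (∀ r, a < r → v r ≤ M)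
  · obtain ⟨a, ha, M, hM, hcore, htail⟩ := hphys
    refine ⟨4 * a, fun N L _ h4a hE ε hε => ?_⟩
    exact stub_truncationEnergyConvergencePhys_of stub_pairCutoffExists stub_truncationMinimisersKineticTightness
      stub_pairShellMassBoundV2 v a M hv ha hcore hM htail N L h4a hE ε hε
  by_cases hsoftc : ∃ a a₀ : ℝ, 0 ≤ a ∧ 0 < a₀ ∧
      (∀ δ : ℝ, 0 < δ → δ ≤ a₀ → ∃ M : ℝ≥0∞, M ≠ ⊤ ∧ ∀ r, a + δ < r → v r ≤ M) ∧
      (∀ (C δ₁ : ℝ), 0 < δ₁ → ∃ δ : ℝ, 0 < δ ∧ δ ≤ δ₁ ∧ δ ≤ a₀ ∧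
        ∀ r, 0 ≤ r → r < a + δ → ENNReal.ofReal (C / δ ^ 2) ≤ v r)
  · obtain ⟨a, a₀, ha, ha₀, htail, hrep⟩ := hsoftc
    refine ⟨4 * (a + a₀), fun N L _ h4a hE ε hε => ?_⟩
    exact stub_truncationEnergyConvergenceSoft_of stub_pairCutoffExistsUniform stub_truncationMinimisersKineticTightness
      stub_pairShellMassBoundUniform v a a₀ hv ha ha₀ htail hrep N L h4a hE ε hε
  · exact ⟨0, fun N L hL _ hE ε hε => stub_truncationEnergyConvergenceAll v hv N L hL hE ε hε⟩

/-! ## A small helper on truncations (admissibility / boundedness are `AlphaPhys.isRepulsiveFiniteRange_min` / `AlphaPhys.min_bounded`) -/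

/-- The truncation keeps every range bound. [folklore] -/
theorem truncation_range {v : ℝ → ℝ≥0∞} {R : ℝ} (hvR : ∀ r, R < r → v r = 0) (n : ℕ) :
    ∀ r, R < r → min (v r) (n : ℝ≥0∞) = 0 := by
  intro r hr
  rw [hvR r hr]
  exact min_eq_left (by simp)

/-! ## The transfer -/

/-- **Uniform minimiser BEC over bounded potentials of range `≤ R` + the uniform truncation Ky Fan gap of `v` ⇒
near-minimiser periodic BEC for `v`** (the fixed-volume transfer of line `third-law-current-floor`; the conclusion is
verbatim the hypothesis of the route's `BoundaryTransferWeak v`). Hypotheses: `v` admissible of range `≤ R`; U(R) =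
uniform minimiser BEC over the bounded admissible class of range `≤ R` (thermodynamic input, BEC type); (β')(v) = a Ky
Fan gap of the truncations `min(v,n)` uniform in `n`, dilute, eventually in `N`, asked only when `∫ v(|x|)dx = ⊤`.
Proof: minimiser BEC for every truncation (U(R) + `boundedPositiveMinimiser_holds`); non-integrable `v`: (α')
(`truncationEnergyConvergence_all`) + (β') + the landed `stub_truncationTransferOfUniformGap`; integrable `v`: the landed
`AlphaInt.truncationTransfer_integrable_of` (Faris–Simon gap of `v`, FK minimisers of the truncations near-optimal for
`v`); Ruelle finiteness supplies `E₀^per(v) < ⊤` eventually; the fraction drops from `c` to `c/2`.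
[cite: LSSY2005, §1.2 (1.19) and Ch. 2; ReedSimonIV1978, Thm XIII.44, XIII.47] -/
theorem periodicBEC_of_uniformMinimiserBEC :
    ∀ v : ℝ → ℝ≥0∞, IsRepulsiveFiniteRange v → ∀ R : ℝ, 0 < R → (∀ r, R < r → v r = 0) →
    (∃ ρ₀ : ℝ, 0 < ρ₀ ∧ ∀ ρ : ℝ, 0 < ρ → ρ < ρ₀ → ∃ c : ℝ, 0 < c ∧
      ∀ᶠ N : ℕ in atTop, ∀ w : ℝ → ℝ≥0∞, IsRepulsiveFiniteRange w →
        (∃ M : ℝ≥0∞, M ≠ ⊤ ∧ ∀ r, w r ≤ M) → (∀ r, R < r → w r = 0) →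
        ∀ Ψ : PeriodicTrialState N (sideLength ρ N),
          periodicEnergy w Ψ = periodicGroundStateEnergy w N (sideLength ρ N) →
          periodicEnergy w Ψ ≠ ⊤ → (∀ X, Ψ.ψ X = (‖Ψ.ψ X‖ : ℂ)) → (∀ X, Ψ.ψ X ≠ 0) →
          ENNReal.ofReal (c * N) ≤ condensateOccupation N (sideLength ρ N) Ψ.ψ) →
    ((∫⁻ x : Space, v ‖x‖) = ⊤ →
      ∃ ρ₁ : ℝ, 0 < ρ₁ ∧ ∀ ρ : ℝ, 0 < ρ → ρ < ρ₁ → ∀ᶠ N : ℕ in atTop,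
        ∃ γ : ℝ, 0 < γ ∧ ∃ n₀ : ℕ, ∀ n : ℕ, n₀ ≤ n →
          2 * periodicGroundStateEnergy (fun r => min (v r) (n : ℝ≥0∞)) N (sideLength ρ N) +
              ENNReal.ofReal γ ≤
            kyFanTwo (fun r => min (v r) (n : ℝ≥0∞)) N (sideLength ρ N)) →
    ∃ ρ₀ : ℝ, 0 < ρ₀ ∧ ∀ ρ : ℝ, 0 < ρ → ρ < ρ₀ → ∃ c : ℝ, 0 < c ∧ ∀ᶠ N : ℕ in atTop,
      ∃ δ : ℝ≥0∞, 0 < δ ∧ ∀ Ψ : PeriodicTrialState N (sideLength ρ N),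
        periodicEnergy v Ψ ≤ periodicGroundStateEnergy v N (sideLength ρ N) + δ →
        ENNReal.ofReal (c * N) ≤ condensateOccupation N (sideLength ρ N) Ψ.ψ := by
  intro v hv R _hR hvR hU hgap
  obtain ⟨ρ₀, hρ₀, hth⟩ := hU
  -- dilute finiteness (Ruelle)
  obtain ⟨ρF, hρF, hfin⟩ :=
    Literature.Barriers.AtomisticToContinuum.BoseGas.exists_eventually_periodicGroundStateEnergy_lt_top hv
  by_cases hint : (∫⁻ x : Space, v ‖x‖) = ⊤
  · -- NON-INTEGRABLE class: (α') energy convergence + (β') uniform truncation gap + the landed transfer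
    obtain ⟨ρ₁, hρ₁, hgapv⟩ := hgap hint
    obtain ⟨L₀, hconv₀⟩ := truncationEnergyConvergence_all v hv
    refine ⟨min ρ₀ (min ρF ρ₁), lt_min hρ₀ (lt_min hρF hρ₁), fun ρ hρ hρlt => ?_⟩
    have hρ₀' : ρ < ρ₀ := hρlt.trans_le (min_le_left _ _)
    have hρF' : ρ < ρF := hρlt.trans_le ((min_le_right _ _).trans (min_le_left _ _))
    have hρ₁' : ρ < ρ₁ := hρlt.trans_le ((min_le_right _ _).trans (min_le_right _ _))
    obtain ⟨c, hc, hN⟩ := hth ρ hρ hρ₀'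
    refine ⟨c / 2, by positivity, ?_⟩
    filter_upwards [hN, hfin ρ hρ hρF', hgapv ρ hρ hρ₁', eventually_ge_atTop 1,
      (tendsto_sideLength_atTop hρ).eventually_gt_atTop L₀] with N hN₁ hN₂ hN₃ hN₄ hN₅
    have hL : 0 < sideLength ρ N := sideLength_pos_of_pos hρ hN₄
    obtain ⟨k, rfl⟩ : ∃ k, N = k + 1 := ⟨N - 1, by omega⟩
    -- positive minimisers of every truncation, each with the uniform bound U(R)
    have hmin : ∀ n : ℕ, ∃ Ψ : PeriodicTrialState (k + 1) (sideLength ρ (k + 1)),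
        periodicEnergy (fun r => min (v r) (n : ℝ≥0∞)) Ψ =
          periodicGroundStateEnergy (fun r => min (v r) (n : ℝ≥0∞)) (k + 1) (sideLength ρ (k + 1)) ∧
        periodicEnergy (fun r => min (v r) (n : ℝ≥0∞)) Ψ ≠ ⊤ ∧
        (∀ X, Ψ.ψ X = (‖Ψ.ψ X‖ : ℂ)) ∧ (∀ X, Ψ.ψ X ≠ 0) ∧
        ENNReal.ofReal (c * (k + 1 : ℕ)) ≤ condensateOccupation (k + 1) (sideLength ρ (k + 1)) Ψ.ψ := by
      intro n
      obtain ⟨Ψ, h₁, h₂, h₃, h₄⟩ := boundedPositiveMinimiser_holds (AlphaPhys.isRepulsiveFiniteRange_min hv n)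
        (AlphaPhys.min_bounded v n) k hL
      exact ⟨Ψ, h₁, h₂, h₃, h₄,
        hN₁ _ (AlphaPhys.isRepulsiveFiniteRange_min hv n) (AlphaPhys.min_bounded v n) (truncation_range hvR n) Ψ h₁ h₂ h₃ h₄⟩
    -- (α') at this `(N, L_N)` and the transfer: near-minimiser BEC for `v` with fraction c - c/2 = c/2
    have hconv := hconv₀ (k + 1) (sideLength ρ (k + 1)) hL hN₅ hN₂.ne
    obtain ⟨δ, hδ, hΦ⟩ := stub_truncationTransferOfUniformGap v hv (k + 1) (sideLength ρ (k + 1)) hL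
      hconv hN₃ c hmin (c / 2) (by positivity)
    refine ⟨δ, hδ, fun Φ hΦE => ?_⟩
    have h := hΦ Φ hΦE
    have hcc : c - c / 2 = c / 2 := by ring
    rw [hcc] at h
    exact h
  · -- INTEGRABLE class: the Ky Fan gap of `v` itself (Faris–Simon, tree) and the FK minimisers of the truncations as
    -- near-minimisers of `v` (node `truncationTransfer_integrable_of` ∘ I1 ∘ I2): neither (α') nor (β') is needed
    refine ⟨min ρ₀ ρF, lt_min hρ₀ hρF, fun ρ hρ hρlt => ?_⟩
    have hρ₀' : ρ < ρ₀ := hρlt.trans_le (min_le_left _ _)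
    have hρF' : ρ < ρF := hρlt.trans_le (min_le_right _ _)
    obtain ⟨c, hc, hN⟩ := hth ρ hρ hρ₀'
    refine ⟨c / 2, by positivity, ?_⟩
    filter_upwards [hN, hfin ρ hρ hρF', eventually_ge_atTop 1] with N hN₁ hN₂ hN₄
    have hL : 0 < sideLength ρ N := sideLength_pos_of_pos hρ hN₄
    obtain ⟨k, rfl⟩ : ∃ k, N = k + 1 := ⟨N - 1, by omega⟩
    obtain ⟨δ, hδ, hΦ⟩ := AlphaInt.truncationTransfer_integrable_of stub_fkPositiveMinimiserSupBound
      stub_interactionExcess_tendsto_zero v hv hint k (sideLength ρ (k + 1)) hL hN₂.ne c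
      (fun n Ψ h₁ h₂ h₃ h₄ =>
        hN₁ _ (AlphaPhys.isRepulsiveFiniteRange_min hv n) (AlphaPhys.min_bounded v n) (truncation_range hvR n) Ψ h₁ h₂ h₃ h₄)
      (c / 2) (by positivity)
    refine ⟨δ, hδ, fun Φ hΦE => ?_⟩
    have h := hΦ Φ hΦE
    have hcc : c - c / 2 = c / 2 := by ring
    rw [hcc] at h
    exact h

end Summit.AtomisticToContinuum.BoseEinsteinCondensation.Cruxes.HardCoreExtension.ThirdLawCurrentFloorAlt

end
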